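import Literature.NumberTheory.Automorphic.ArithmeticQuotientCohomology
import Mathlib.Algebra.Colimit.Module
import Mathlib.RingTheory.Ideal.Quotient.Defs
import Mathlib.LinearAlgebra.Quotient.Basic
import HarnessLib

/-!
# Emerton's `p`-adically completed cohomology and the big Hecke algebra

Topic `NumberTheory/Automorphic`; continues `ArithmeticQuotientCohomology` (`ι : Γ →* 𝒢` =
rational → finite-adelic points, levels `L ≤ 𝒢`, `H^i(X_L, M) = ArithmeticQuotient.cohomology`
with Hecke operators `T_g`).  Contents:

* `ArithmeticQuotient.heckeAlgebra k ι L M δ i = 𝕋(L, M, i)`, the `k`-subalgebra of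
  `End_k H^i(X_L, M)` generated by the `T_{δ j}` of a family `δ : J → 𝒢` of Hecke elements (for the
  spherical `t_{v,j}`, `v ∉ S`: the image `𝕋_{F,S}(K, i, m)` of [Scholze2015, Thm. V.4.1]), and
  `ArithmeticQuotient.IsHeckeEigenclass` (non-zero simultaneous eigenclass, eigenvalues `χ : J → k`;
  [Scholze2015, Cor. V.4.3]).
* `LevelTower 𝒢`: an antitone sequence of levels `K(0) ≥ K(1) ≥ ⋯` (the `Kᵖ K_p(p^s)`; the `G_r`
  of [CalegariEmerton2011, §1]); `LevelTower.ofSeq` builds one from a tame level and any sequence.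
* coefficients `modPow k ϖ t = k ⧸ (ϖ^t)` and the reductions `modPowReduce` (`ϖ = p` in `k = ℤ`,
  `ℤ_p`, `𝒪_E` gives `ℤ/p^t`, `ℤ_p/p^t`, `𝒪_E/p^t`).
* **Completed cohomology** [CalegariEmerton2011, §§1, 5], [Emerton2006, §2.2], [Scholze2015,
  Ch. IV intro]: `completedCohomologyMod k ι T ϖ i t = H̃^i(k/ϖ^t) := colim_s H^i(X_{K(s)}, k/ϖ^t)`
  (`Module.DirectLimit` along the pull-backs) and `completedCohomology k ι T ϖ i = H̃^i :=
  lim_t H̃^i(k/ϖ^t)` (the submodule of compatible sequences in `Π_t H̃^i(k/ϖ^t)`), with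
  `toCompletedCohomologyMod : H^i(X_{K(s)}, k/ϖ^t) → H̃^i(k/ϖ^t)` and `CompletedCohomology.proj`.
* **Big Hecke algebra** `bigHeckeAlgebra k ι T ϖ δ = 𝕋(Kᵖ)`: the image `towerHeckeAlgebra` of the
  abstract Hecke algebra acting diagonally on `⊕_{i,s,t} H^i(X_{K(s)}, k/ϖ^t)` (a subalgebra of
  `Π_{i,s,t} End H^i(X_{K(s)}, k/ϖ^t)`), closed up for the product of the discrete topologies = the
  inverse limit over finite index sets `I` of its images `𝕋_I` in `End(⊕_I H)`, i.e. the usual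
  `𝕋(Kᵖ) = lim_{s,t} 𝕋(Kᵖ K_p(p^s), ℤ/p^t)` ([Emerton2006, §2.2]; finite levels as in
  [Scholze2015, Thm. V.4.1, Rem. V.4.5]).
* `EigensystemOccurs k ι T ϖ δ χ i`: for every `t` some level `K(s)` carries a Hecke eigenclass in
  `H^i(X_{K(s)}, k/ϖ^{t+1})` with eigenvalues `χ` and exact annihilator `(ϖ^{t+1})` (torsion form),
  and `IsHeckePoint k ι T ϖ δ χ`: `T_{δ j} ↦ χ j` extends to continuous `k`-algebra maps
  `𝕋(Kᵖ) → k/ϖ^t` for all `t` ("`χ` is a point of `Spf 𝕋(Kᵖ)`").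
* `completedHeckeMod`, `completedHecke`: `T_g` on `H̃^i(k/ϖ^t)` and `H̃^i` for `g` whose operators
  commute with the pull-backs of the tower (`IsTowerCompatible`; e.g. `g` trivial at `p`).

NOT here (first landing): the `G(ℚ_p)`-action on `H̃^i` and continuity, `ϖ`-adic completeness /
admissibility ([CalegariEmerton2011, Thm. 1]), completed homology and the `BM`/`c` variants, the
comparison with classical automorphic forms (Emerton's spectral sequence), faithfulness and
noetherianity of `𝕋(Kᵖ)`, and `IsTowerCompatible` for prime-to-`p` elements of `GL_n`.
The case `G = GL_n` over a number field is `CompletedCohomologyGL`.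

## References

* F. Calegari, M. Emerton, *Completed cohomology — a survey*, LMS LN 393 (2012), §§1, 5, 8
  [CalegariEmerton2011]; M. Emerton, Invent. Math. 164 (2006), §2.2 [Emerton2006];
  P. Scholze, Ann. of Math. 182 (2015), Ch. IV intro and §V.4 [Scholze2015].
-/

noncomputable section

open CategoryTheory

universe u v

namespace Literature.NumberTheory.Automorphic

/-! ### Hecke algebras and eigenclasses at finite level -/

namespace ArithmeticQuotient

variable (k : Type u) [CommRing k] {Γ 𝒢 : Type u} [Group Γ] [Group 𝒢]
variable (ι : Γ →* 𝒢) (L : Subgroup 𝒢) (M : Type u) [AddCommGroup M] [Module k M] {J : Type v}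

open scoped Classical in
omit [Group Γ] in
/-- The Hecke operator on functions is independent of the coset representative:
`(T_g f)(xL) = ∑_{d ∈ LgL/L} f(x • d)` for every `x`. [folklore] -/
theorem heckeFun_apply_coe (g : 𝒢) (f : (𝒢 ⧸ L) → M) (x : 𝒢) (h : (doubleCosetQuot L g).Finite) :
    heckeFun k L g M f (x : 𝒢 ⧸ L) = ∑ d ∈ h.toFinset, f (x • d) := by
  rw [heckeFun_apply, dif_pos h]
  obtain ⟨l, hl⟩ := QuotientGroup.mk_out_eq_mul L x
  rw [hl]
  simp_rw [mul_smul]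
  exact sum_doubleCosetQuot_coe_smul h l fun d => f (x • d)

/-- `T_1 = [L] = 1` on `H^i(X_L, M)`. [folklore] -/
@[simp]
theorem heckeEnd_one (i : ℕ) : heckeEnd k L (1 : 𝒢) M ι i = LinearMap.id := by
  have h1 : heckeRepHom k L (1 : 𝒢) M ι = 𝟙 _ :=
    Rep.hom_ext (Representation.IntertwiningMap.ext (heckeFun_one k L M))
  simp only [heckeEnd, heckeOperator, h1, groupCohomology.map_id]
  rfl

/-- **The Hecke algebra `𝕋(L, M, i; δ)` of level `L` in degree `i`**: the `k`-subalgebra of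
`End_k H^i(X_L, M)` generated by the Hecke operators `T_{δ j}` of a family `δ : J → 𝒢` of Hecke
elements (e.g. the `t_{v,j}`, `v ∉ S`).  For `δ` generating the spherical Hecke algebra away from
`S` this is the image `𝕋_{F,S}(K, i, m) = im(𝕋_{F,S} → End(H^i(X_K, ℤ/p^m)))` of
[Scholze2015, Thm. V.4.1] (the `k`-span of the double-coset operators is already a subalgebra).
[cite: Scholze2015, §V.4, Thm. V.4.1] -/
def heckeAlgebra (δ : J → 𝒢) (i : ℕ) : Subalgebra k (Module.End k (cohomology k ι L M i)) :=
  Algebra.adjoin k (Set.range fun j => heckeEnd k L (δ j) M ι i)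

/-- The generators `T_{δ j}` lie in the Hecke algebra. [folklore] -/
theorem heckeEnd_mem_heckeAlgebra (δ : J → 𝒢) (j : J) (i : ℕ) :
    heckeEnd k L (δ j) M ι i ∈ heckeAlgebra k ι L M δ i :=
  Algebra.subset_adjoin ⟨j, rfl⟩

variable {k}

/-- **Hecke eigenclass**: `c ∈ H^i(X_L, M)` is a non-zero simultaneous eigenvector of the
`T_{δ j}`, `j : J`, with eigenvalues `χ j ∈ k` ("the system of Hecke eigenvalues `χ` occurs in
`H^i(X_L, M)`", [Scholze2015, Cor. V.4.3]). [cite: Scholze2015, §V.4, Cor. V.4.3] -/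
def IsHeckeEigenclass (δ : J → 𝒢) (χ : J → k) (i : ℕ) (c : cohomology k ι L M i) : Prop :=
  c ≠ 0 ∧ ∀ j, heckeEnd k L (δ j) M ι i c = χ j • c

/-- On a Hecke eigenclass every element of the Hecke algebra acts by a scalar. [folklore] -/
theorem IsHeckeEigenclass.exists_smul {δ : J → 𝒢} {χ : J → k} {i : ℕ} {c : cohomology k ι L M i}
    (h : IsHeckeEigenclass ι L M δ χ i c) {T : Module.End k (cohomology k ι L M i)}
    (hT : T ∈ heckeAlgebra k ι L M δ i) : ∃ a : k, T c = a • c := by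
  refine Algebra.adjoin_induction (fun T hT => ?_) (fun r => ⟨r, by simp⟩)
    (fun T T' _ _ hT hT' => ?_) (fun T T' _ _ hT hT' => ?_) hT
  · obtain ⟨j, rfl⟩ := hT
    exact ⟨χ j, h.2 j⟩
  · obtain ⟨a, ha⟩ := hT
    obtain ⟨b, hb⟩ := hT'
    exact ⟨a + b, by rw [LinearMap.add_apply, ha, hb, add_smul]⟩
  · obtain ⟨a, ha⟩ := hT
    obtain ⟨b, hb⟩ := hT'
    exact ⟨b * a, by rw [Module.End.mul_apply, hb, map_smul, ha, mul_smul]⟩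

end ArithmeticQuotient

/-! ### Towers of levels and `ϖ`-power-torsion coefficients -/

/-- A **tower of levels** in `𝒢`: an antitone sequence of subgroups
`K(0) ≥ K(1) ≥ K(2) ≥ ⋯` (in the applications `K(s) = Kᵖ K_p(p^s)` for a tame level `Kᵖ` and
the principal congruence subgroups `K_p(p^s)` at `p`; the `G_r` of [CalegariEmerton2011, §1]).
[cite: CalegariEmerton2011, §1] -/
structure LevelTower (𝒢 : Type u) [Group 𝒢] where
  /-- The `s`-th level `K(s)`. -/
  level : ℕ → Subgroup 𝒢
  antitone' : Antitone level

namespace LevelTower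

variable {𝒢 : Type u} [Group 𝒢] (T : LevelTower 𝒢)

/-- `K(s') ≤ K(s)` for `s ≤ s'`. [folklore] -/
theorem level_le {s s' : ℕ} (h : s ≤ s') : T.level s' ≤ T.level s :=
  T.antitone' h

/-- The tower `s ↦ Ktame ⊓ ⨅_{r ≤ s} K r` built from a tame level `Kᵖ` and any sequence of subgroups
`K` (antitone by construction; equal to `Ktame ⊓ K s` when `K` is itself antitone).
[folklore] -/
def ofSeq (Ktame : Subgroup 𝒢) (K : ℕ → Subgroup 𝒢) : LevelTower 𝒢 where
  level s := Ktame ⊓ ⨅ (r : ℕ) (_ : r ≤ s), K r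
  antitone' _ _ h := inf_le_inf_left _ (biInf_mono fun _ hr => hr.trans h)

/-- Unfolding lemma for `ofSeq`. [folklore] -/
theorem ofSeq_level (Ktame : Subgroup 𝒢) (K : ℕ → Subgroup 𝒢) (s : ℕ) :
    (ofSeq Ktame K).level s = Ktame ⊓ ⨅ (r : ℕ) (_ : r ≤ s), K r :=
  rfl

end LevelTower

section Coefficients

variable (k : Type u) [CommRing k] (ϖ : k)

/-- The coefficient ring/module `k ⧸ (ϖ^t)` (`ℤ/p^t` for `k = ℤ`, `ϖ = p`). [folklore] -/
abbrev modPow (t : ℕ) : Type u :=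
  k ⧸ Ideal.span {ϖ ^ t}

/-- The reduction `k/ϖ^{t+1} → k/ϖ^t`, `k`-linear. [folklore] -/
def modPowReduce (t : ℕ) : modPow k ϖ (t + 1) →ₗ[k] modPow k ϖ t :=
  Submodule.factor (Ideal.span_singleton_le_span_singleton.mpr (pow_dvd_pow ϖ t.le_succ))

end Coefficients

/-! ### Completed cohomology of a tower -/

section Completed

variable (k : Type u) [CommRing k] {Γ 𝒢 : Type u} [Group Γ] [Group 𝒢]
variable (ι : Γ →* 𝒢) (T : LevelTower 𝒢) (ϖ : k)

/-- `H^i(X_{K(s)}, k/ϖ^t)`: cohomology of level `K(s)` of the tower with `ϖ^t`-torsion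
coefficients. [folklore] -/
abbrev towerCohomology (i s t : ℕ) : ModuleCat k :=
  ArithmeticQuotient.cohomology k ι (T.level s) (modPow k ϖ t) i

/-- The pull-back `H^i(X_{K(s)}, k/ϖ^t) → H^i(X_{K(s')}, k/ϖ^t)` for `s ≤ s'`. [folklore] -/
abbrev towerPullback (i t : ℕ) {s s' : ℕ} (h : s ≤ s') :
    towerCohomology k ι T ϖ i s t ⟶ towerCohomology k ι T ϖ i s' t :=
  ArithmeticQuotient.cohomologyPullback k ι (modPow k ϖ t) (T.level_le h) i

/-- The reduction of coefficients `H^i(X_{K(s)}, k/ϖ^{t+1}) → H^i(X_{K(s)}, k/ϖ^t)`. [folklore] -/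
abbrev towerReduce (i s t : ℕ) :
    towerCohomology k ι T ϖ i s (t + 1) ⟶ towerCohomology k ι T ϖ i s t :=
  ArithmeticQuotient.cohomologyCoeffMap ι (T.level s) (modPowReduce k ϖ t) i

/-- The transition maps `s ≤ s' ↦ (H^i(X_{K(s)}, k/ϖ^t) → H^i(X_{K(s')}, k/ϖ^t))` of the direct
system, as linear maps. [folklore] -/
abbrev towerTransition (i t : ℕ) :
    ∀ s s' : ℕ, s ≤ s' → (towerCohomology k ι T ϖ i s t →ₗ[k] towerCohomology k ι T ϖ i s' t) :=
  fun _ _ h => (towerPullback k ι T ϖ i t h).hom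

/-- **Completed cohomology with `ϖ^t`-torsion coefficients**
`H̃^i(k/ϖ^t) := colim_s H^i(X_{K(s)}, k/ϖ^t)` along the pull-backs of the tower
(`H̃^i_{K^p}(ℤ/p^n) = colim_{K_p} H^i(X_{K_pK^p}, ℤ/p^n)` of [Scholze2015, Ch. IV intro];
the inner direct limit of [CalegariEmerton2011, §1]). [cite: CalegariEmerton2011, §1] -/
abbrev completedCohomologyMod (i t : ℕ) : Type u :=
  Module.DirectLimit (fun s => towerCohomology k ι T ϖ i s t) (towerTransition k ι T ϖ i t)

/-- The structure map `H^i(X_{K(s)}, k/ϖ^t) → H̃^i(k/ϖ^t)`. [folklore] -/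
abbrev toCompletedCohomologyMod (i s t : ℕ) :
    towerCohomology k ι T ϖ i s t →ₗ[k] completedCohomologyMod k ι T ϖ i t :=
  Module.DirectLimit.of k ℕ (fun s => towerCohomology k ι T ϖ i s t) (towerTransition k ι T ϖ i t) s

/-- Reduction of coefficients commutes with the pull-backs of the tower (as linear maps).
[folklore] -/
theorem towerReduce_comp_towerPullback (i t : ℕ) {s s' : ℕ} (h : s ≤ s') :
    (towerReduce k ι T ϖ i s' t).hom ∘ₗ towerTransition k ι T ϖ i (t + 1) s s' h =
      towerTransition k ι T ϖ i t s s' h ∘ₗ (towerReduce k ι T ϖ i s t).hom := by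
  rw [← ModuleCat.hom_comp, ← ModuleCat.hom_comp, towerReduce, towerPullback,
    ArithmeticQuotient.cohomologyCoeffMap_comp_cohomologyPullback]

/-- The reduction `H̃^i(k/ϖ^{t+1}) → H̃^i(k/ϖ^t)` induced on the direct limits. [folklore] -/
def completedCohomologyModReduce (i t : ℕ) :
    completedCohomologyMod k ι T ϖ i (t + 1) →ₗ[k] completedCohomologyMod k ι T ϖ i t :=
  Module.DirectLimit.map (f := towerTransition k ι T ϖ i (t + 1)) (f' := towerTransition k ι T ϖ i t)
    (fun s => (towerReduce k ι T ϖ i s t).hom) fun _ _ h => towerReduce_comp_towerPullback k ι T ϖ i t h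

/-- `completedCohomologyModReduce` on the image of level `K(s)`. [folklore] -/
@[simp]
theorem completedCohomologyModReduce_of (i s t : ℕ) (x : towerCohomology k ι T ϖ i s (t + 1)) :
    completedCohomologyModReduce k ι T ϖ i t (toCompletedCohomologyMod k ι T ϖ i s (t + 1) x) =
      toCompletedCohomologyMod k ι T ϖ i s t ((towerReduce k ι T ϖ i s t).hom x) := by
  rw [completedCohomologyModReduce, Module.DirectLimit.map_apply_of]

/-- **Completed cohomology** `H̃^i := lim_t colim_s H^i(X_{K(s)}, k/ϖ^t)` of the tower `T`
(Emerton; [CalegariEmerton2011, §1]: `H̃^• := lim_s colim_r H^•(X_r, ℤ/p^s)`), realised as the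
`k`-submodule of compatible sequences in `Π_t H̃^i(k/ϖ^t)`.  For `Γ = G(ℚ) → 𝒢 = G(𝔸_f)` and
`K(s) = Kᵖ K_p(p^s)` this is `H̃^i(Kᵖ)` [CalegariEmerton2011, §5], [Emerton2006, §2.2].
[cite: CalegariEmerton2011, §1 and §5] -/
def completedCohomology (i : ℕ) : Submodule k (∀ t, completedCohomologyMod k ι T ϖ i t) where
  carrier := {x | ∀ t, completedCohomologyModReduce k ι T ϖ i t (x (t + 1)) = x t}
  add_mem' hx hy t := by simp [hx t, hy t]
  zero_mem' t := by simp
  smul_mem' r x hx t := by simp [hx t]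

/-- The projection `H̃^i → H̃^i(k/ϖ^t)`. [folklore] -/
def CompletedCohomology.proj (i t : ℕ) :
    completedCohomology k ι T ϖ i →ₗ[k] completedCohomologyMod k ι T ϖ i t :=
  (LinearMap.proj t).comp (completedCohomology k ι T ϖ i).subtype

/-! ### The big Hecke algebra -/

variable {J : Type v}

/-- The index set `(i, s, t)` of the finite pieces `H^i(X_{K(s)}, k/ϖ^t)`. [folklore] -/
abbrev TowerIndex : Type := ℕ × ℕ × ℕ

/-- The ring `Π_{(i,s,t)} End_k H^i(X_{K(s)}, k/ϖ^t)` in which the Hecke algebras live.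
[folklore] -/
abbrev towerEndProd : Type u :=
  ∀ x : TowerIndex, Module.End k (towerCohomology k ι T ϖ x.1 x.2.1 x.2.2)

/-- The diagonal family `(T_g on H^i(X_{K(s)}, k/ϖ^t))_{i,s,t}` of Hecke operators of `g`.
[folklore] -/
def towerHeckeFamily (g : 𝒢) : towerEndProd k ι T ϖ :=
  fun x => ArithmeticQuotient.heckeEnd k (T.level x.2.1) g (modPow k ϖ x.2.2) ι x.1

/-- The image of the abstract Hecke algebra generated by the `T_{δ j}` acting diagonally on
`⊕_{i,s,t} H^i(X_{K(s)}, k/ϖ^t)`: the `k`-subalgebra of `Π End` generated by the diagonal Hecke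
families.  Its projection to the factors with `s, t` fixed is the finite-level algebra
`𝕋(K(s), k/ϖ^t)` of [Scholze2015, Rem. V.4.5] (all degrees at once). [cite: Scholze2015, §V.4, Rem. V.4.5] -/
def towerHeckeAlgebra (δ : J → 𝒢) : Subalgebra k (towerEndProd k ι T ϖ) :=
  Algebra.adjoin k (Set.range fun j => towerHeckeFamily k ι T ϖ (δ j))

/-- **The big Hecke algebra `𝕋(Kᵖ)`** of the tower: the closure of `towerHeckeAlgebra` in
`Π_{i,s,t} End H^i(X_{K(s)}, k/ϖ^t)` for the product of the discrete topologies, i.e. the families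
of endomorphisms which on every finite set of indices agree with an element of the Hecke algebra —
the inverse limit over finite index sets `I` of the images `𝕋_I` of the Hecke algebra in
`End(⊕_{I} H^i(X_{K(s)}, k/ϖ^t))`, which is the usual `𝕋(Kᵖ) = lim_{s,t} 𝕋(Kᵖ K_p(p^s), ℤ/p^t)`
([Emerton2006, §2.2]; [CalegariEmerton2011, §5]). [cite: CalegariEmerton2011, §5] -/
def bigHeckeAlgebra (δ : J → 𝒢) : Subalgebra k (towerEndProd k ι T ϖ) where
  carrier := {x | ∀ I : Finset TowerIndex, ∃ a ∈ towerHeckeAlgebra k ι T ϖ δ, ∀ y ∈ I, x y = a y}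
  mul_mem' {x x'} hx hx' I := by
    obtain ⟨a, ha, hxa⟩ := hx I
    obtain ⟨b, hb, hxb⟩ := hx' I
    exact ⟨a * b, mul_mem ha hb, fun y hy => by rw [Pi.mul_apply, Pi.mul_apply, hxa y hy, hxb y hy]⟩
  add_mem' {x x'} hx hx' I := by
    obtain ⟨a, ha, hxa⟩ := hx I
    obtain ⟨b, hb, hxb⟩ := hx' I
    exact ⟨a + b, add_mem ha hb, fun y hy => by rw [Pi.add_apply, Pi.add_apply, hxa y hy, hxb y hy]⟩
  algebraMap_mem' r I := ⟨algebraMap k _ r, Subalgebra.algebraMap_mem _ r, fun _ _ => rfl⟩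

/-- The diagonal Hecke families `T_{δ j}` lie in the big Hecke algebra (which contains, as a dense
subalgebra, `towerHeckeAlgebra`). [folklore] -/
theorem towerHeckeFamily_mem_bigHeckeAlgebra (δ : J → 𝒢) (j : J) :
    towerHeckeFamily k ι T ϖ (δ j) ∈ bigHeckeAlgebra k ι T ϖ δ :=
  fun _ => ⟨_, Algebra.subset_adjoin ⟨j, rfl⟩, fun _ _ => rfl⟩

/-! ### Systems of Hecke eigenvalues occurring in completed cohomology -/

variable {k}

/-- **The system of Hecke eigenvalues `χ : J → k` occurs in the completed cohomology of the tower
in degree `i`** (eigenclass form): for every `t` there are a level `K(s)` and a Hecke eigenclass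
`c ∈ H^i(X_{K(s)}, k/ϖ^{t+1})` with `T_{δ j} c = χ j • c` for all `j`, whose annihilator in `k` is
exactly `(ϖ^{t+1})` — so that these equations determine `χ mod ϖ^{t+1}` (with `c ≠ 0` alone a
`ϖ`-torsion class would witness every stage and only `χ mod ϖ` would be seen).  Torsion classes
are allowed; no lifting to characteristic `0` is required.  Cf. [Scholze2015, Cor. V.4.3] (one
finite level, `𝔽̄_p`-coefficients); the `Spf 𝕋(Kᵖ)`-form is `IsHeckePoint`. [cite: Scholze2015, §V.4, Cor. V.4.3] -/
def EigensystemOccurs (δ : J → 𝒢) (χ : J → k) (i : ℕ) : Prop :=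
  ∀ t : ℕ, ∃ (s : ℕ) (c : towerCohomology k ι T ϖ i s (t + 1)),
    ArithmeticQuotient.IsHeckeEigenclass ι (T.level s) (modPow k ϖ (t + 1)) δ χ i c ∧
      ∀ a : k, a • c = 0 → a ∈ Ideal.span {ϖ ^ (t + 1)}

/-- **`χ : J → k` is a (`k`-valued) point of `Spf 𝕋(Kᵖ)`** (algebra form): for every `t` the
assignment `T_{δ j} ↦ χ j mod ϖ^t` extends to a `k`-algebra homomorphism
`𝕋(Kᵖ) → k/ϖ^t` which is continuous, i.e. factors through the restriction to finitely many of the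
`H^i(X_{K(s)}, k/ϖ^t)` (equivalently: through one of the finite-level Hecke algebras).
[cite: CalegariEmerton2011, §8] -/
def IsHeckePoint (δ : J → 𝒢) (χ : J → k) : Prop :=
  ∀ t : ℕ, ∃ (I : Finset TowerIndex) (φ : bigHeckeAlgebra k ι T ϖ δ →ₐ[k] modPow k ϖ t),
    (∀ x y : bigHeckeAlgebra k ι T ϖ δ, (∀ z ∈ I, x.1 z = y.1 z) → φ x = φ y) ∧
      ∀ j, φ ⟨towerHeckeFamily k ι T ϖ (δ j), towerHeckeFamily_mem_bigHeckeAlgebra k ι T ϖ δ j⟩ =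
        Ideal.Quotient.mk _ (χ j)

/-! ### Hecke operators on completed cohomology (for tower-compatible Hecke elements) -/

variable (k)

/-- `g` is **compatible with the tower**: its Hecke operators commute with all pull-backs
`H^i(X_{K(s)}, k/ϖ^t) → H^i(X_{K(s')}, k/ϖ^t)` (true when `K(s') g K(s') / K(s') → K(s) g K(s) / K(s)`
is bijective for all `s ≤ s'`, e.g. for the `p`-power tower and `g` trivial at `p`). [folklore] -/
def IsTowerCompatible (g : 𝒢) : Prop :=
  ∀ (i t s s' : ℕ) (h : s ≤ s'),
    ArithmeticQuotient.heckeEnd k (T.level s') g (modPow k ϖ t) ι i ∘ₗ towerTransition k ι T ϖ i t s s' h =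
      towerTransition k ι T ϖ i t s s' h ∘ₗ ArithmeticQuotient.heckeEnd k (T.level s) g (modPow k ϖ t) ι i

variable {k ι T ϖ}

/-- The Hecke operator `T_g` on `H̃^i(k/ϖ^t)` for a tower-compatible `g`. [folklore] -/
def completedHeckeMod {g : 𝒢} (hg : IsTowerCompatible k ι T ϖ g) (i t : ℕ) :
    Module.End k (completedCohomologyMod k ι T ϖ i t) :=
  Module.DirectLimit.map (f := towerTransition k ι T ϖ i t) (f' := towerTransition k ι T ϖ i t)
    (fun s => ArithmeticQuotient.heckeEnd k (T.level s) g (modPow k ϖ t) ι i) (hg i t)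

/-- `completedHeckeMod` on the image of level `K(s)`. [folklore] -/
@[simp]
theorem completedHeckeMod_of {g : 𝒢} (hg : IsTowerCompatible k ι T ϖ g) (i s t : ℕ)
    (x : towerCohomology k ι T ϖ i s t) :
    completedHeckeMod hg i t (toCompletedCohomologyMod k ι T ϖ i s t x) =
      toCompletedCohomologyMod k ι T ϖ i s t
        (ArithmeticQuotient.heckeEnd k (T.level s) g (modPow k ϖ t) ι i x) := by
  rw [completedHeckeMod, Module.DirectLimit.map_apply_of]

variable (k ι T ϖ) in
/-- At a fixed level, `T_g` commutes with the reduction of coefficients. [folklore] -/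
theorem towerReduce_heckeEnd (g : 𝒢) (i s t : ℕ) (x : towerCohomology k ι T ϖ i s (t + 1)) :
    (towerReduce k ι T ϖ i s t).hom (ArithmeticQuotient.heckeEnd k (T.level s) g (modPow k ϖ (t + 1)) ι i x) =
      ArithmeticQuotient.heckeEnd k (T.level s) g (modPow k ϖ t) ι i ((towerReduce k ι T ϖ i s t).hom x) := by
  change (ArithmeticQuotient.heckeOperator k (T.level s) g (modPow k ϖ (t + 1)) ι i ≫
      towerReduce k ι T ϖ i s t).hom x =
    (towerReduce k ι T ϖ i s t ≫ ArithmeticQuotient.heckeOperator k (T.level s) g (modPow k ϖ t) ι i).hom x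
  rw [towerReduce, ArithmeticQuotient.heckeOperator_comp_cohomologyCoeffMap]

/-- `T_g` on `H̃^i(k/ϖ^•)` commutes with the reductions. [folklore] -/
theorem completedCohomologyModReduce_completedHeckeMod {g : 𝒢} (hg : IsTowerCompatible k ι T ϖ g)
    (i t : ℕ) (x : completedCohomologyMod k ι T ϖ i (t + 1)) :
    completedCohomologyModReduce k ι T ϖ i t (completedHeckeMod hg i (t + 1) x) =
      completedHeckeMod hg i t (completedCohomologyModReduce k ι T ϖ i t x) := by
  induction x using Module.DirectLimit.induction_on with
  | ih s x =>
    rw [completedHeckeMod_of, completedCohomologyModReduce_of, completedCohomologyModReduce_of,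
      completedHeckeMod_of, towerReduce_heckeEnd]

/-- **The Hecke operator `T_g` on completed cohomology `H̃^i`** for a tower-compatible `g`
(the compatible family of the `completedHeckeMod`). [folklore] -/
def completedHecke {g : 𝒢} (hg : IsTowerCompatible k ι T ϖ g) (i : ℕ) :
    Module.End k (completedCohomology k ι T ϖ i) where
  toFun x := ⟨fun t => completedHeckeMod hg i t (x.1 t), fun t => by
    rw [completedCohomologyModReduce_completedHeckeMod, x.2 t]⟩
  map_add' x y := by
    ext t
    simp
  map_smul' r x := by
    ext t
    simp

/-- `completedHecke` followed by the projection to `H̃^i(k/ϖ^t)` (definitional). [folklore] -/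
@[simp]
theorem proj_completedHecke {g : 𝒢} (hg : IsTowerCompatible k ι T ϖ g) (i t : ℕ)
    (x : completedCohomology k ι T ϖ i) :
    CompletedCohomology.proj k ι T ϖ i t (completedHecke hg i x) =
      completedHeckeMod hg i t (CompletedCohomology.proj k ι T ϖ i t x) :=
  rfl

end Completed

end Literature.NumberTheory.Automorphic
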